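import Summits.BirchSwinnertonDyer.BirchSwinnertonDyer.Theorems.ErratumRoadFiveNonSurjCornerKolyJLevelTransverse
import Summits.BirchSwinnertonDyer.BirchSwinnertonDyer.Theorems.ClassRecordThreeEulerHalvesAtThreeWalkSupplySelmer
import Summits.BirchSwinnertonDyer.BirchSwinnertonDyer.Theorems.Rank1ResidualJetKolyvaginDecompositionTrivial
import HarnessLib

/-!
# The ROOT form of the transverse gap `htr` REDUCES to bsd-jet's `htr` (classes of the derived points
# themselves) one level up: `c_k(Q)` with `p^u Q = P_s` is transverse at the primes of `s` as soon as
# `c_{k+u}(P_s)` is (cell `bsd-stepL`, seat `bsd-stepL-tam3-p1`, helper toward item 19109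
# `EulerHalvesAtThree`, registered stub `stub_completionGapsAtThree`)

HONEST FRAMING. Nothing here proves BSD, J₃ or any divisibility of a Heegner point; no stub is
discharged; no item closes; 0 classes move (T7); `--supports stmt-BirchSwinnertonDyer-19109` (helper).

WHAT THIS FILE DOES. The supply theorem `Koly.selmerSupplyAtThree_of_kernelGaps` takes the completion-
layer gap `htr` in ROOT form (the McCallum class `c_k(Q)` of a `p^u`-th root `Q` of `P_s` lies in
`transverseKer ℓ` for `ℓ ∣ s`), bsd-jet's END FORMS take it for the classes `c_k(P_c)` only. Here the
root form is DERIVED from bsd-jet's form at level `k + u`: `ι_* c_k(Q) = c_{k+u}(P_s)` (this seat's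
`torsionH1OfDvd_rootClass`, p524892), the transverse condition of the walk's GLOBAL intrinsic family is
cartesian under `ι_*` at a place whose decomposition group fixes `E[p^{k+u}]` (corner-p1 g9's
`localization_torsionH1OfDvd_mem_globalTransverse_iff`), and at the prime over a Kolyvagin `ℓ` of index
`≥ k + u` the local Galois group fixes `E[p^{k+u}]` (bsd-jet pv-1's
`GlobalDuality.smul_torsion_eq_self_of_mem_decompositionSubgroup`, Zhang currency, through
`decompositionSubgroup_adicCompletionPrime_eq_range`). RESULTS: `resGal_adicCompletion_smul_torsion_eq_self`
(the local triviality in the completion currency), `localization_rootClass_mem_globalTransverse` (the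
root class is transverse at the places of `s` for the level-`k` global family, GIVEN `c_{k+u}(P_s) ∈
transverseKer_{k+u} ℓ` for `ℓ ∣ s`), and `rootClass_mem_selmerGroup_selmerF_of_levelUp` (the supply's
`hselmer` at one conductor from [GZ86 III (3.1)] and bsd-jet's `htr` shape at level `k + u`).
References (locators only; no cited FACT is declared): [cite: Jetchev2008, §3.1 item 7 (p. 817), §3.1.2,
Lemma 4.3] [cite: McCallumLMS1991, §3 (3), §4 Lemma 4.6] [cite: GrossLMS1991, Prop. 9.6, §4 (4.4)]
[cite: Howard2004HeegnerKolyvagin, Lemma 2.7.3] [cite: MazurRubin2004, Def. 1.1.6]. Design: no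
definitions; `K : Type`. Axioms: `propext`, `Classical.choice`, `Quot.sound`.
-/

set_option autoImplicit false

noncomputable section

open scoped Classical Pointwise
open Function NumberField IsDedekindDomain WeierstrassCurve Field
open Literature.NumberTheory.EllipticCurves Literature.NumberTheory.GaloisRepresentations
open Literature.NumberTheory.EllipticCurves.Jetchev2008 Literature.NumberTheory.EllipticCurves.KolyvaginCocycle
open Literature.NumberTheory.EllipticCurves.ModularForms
open Literature.NumberTheory.GaloisCohomology Literature.NumberTheory.Automorphic
open Literature.NumberTheory.GaloisRepresentations.DiscreteGaloisModule (transverseSubgroup SelmerStructure)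
open Summit.BirchSwinnertonDyer.Rank1Residual.JET.SelmerVocabulary
open Summit.BirchSwinnertonDyer.Rank1Residual.JET.GlobalDuality
open Summit.BirchSwinnertonDyer.Rank1Residual.X11b
open Summit.BirchSwinnertonDyer.BirchSwinnertonDyer.Theorems

namespace Summit.BirchSwinnertonDyer.Rank1Residual.JET.Walk

variable {K : Type} [Field K] [NumberField K] (W : WeierstrassCurve ℚ) [W.IsElliptic]
  [W.IsGloballyMinimal] [NeZero (W.conductorNorm ℤ)]

omit [NeZero (W.conductorNorm ℤ)] in
/-- **`Γ_{K_λ}` fixes `E[p^k]` at the prime `λ` over a Zhang–Kolyvagin prime `ℓ` of index `≥ k`**, in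
the completion currency (`resGal : Γ_{K_λ} → Γ_K` lands in the decomposition group of the prime cut out
by `K̄ → K̄_λ`, which fixes `E[p^k]` by bsd-jet pv-1's `smul_torsion_eq_self_of_mem_decompositionSubgroup`).
[cite: GrossLMS1991, Prop. 9.6] [cite: McCallumLMS1991, §3 (3)] [cite: NeukirchANT1999, Ch. II §9 Prop. (9.6)] -/
theorem resGal_adicCompletion_smul_torsion_eq_self (hK : IsImaginaryQuadratic K) {p : ℕ} [Fact p.Prime]
    {k ℓ : ℕ} (hℓ : Zhang2014.IsKolyvaginPrime (W.conductorNorm ℤ) W K p ℓ)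
    (hk : k ≤ Zhang2014.kolyvaginIndex W p ℓ) (v : HeightOneSpectrum (𝓞 K)) (hv : (ℓ : 𝓞 K) ∈ v.asIdeal)
    (g : absoluteGaloisGroup (v.adicCompletion K)) (Q : geomTorsion (W.baseChange K) ((p ^ k : ℕ) : ℤ)) :
    resGal (K := K) (v.adicCompletion K) g • Q = Q := by
  have hd : resGal (K := K) (v.adicCompletion K) g ∈
      (adicCompletionPrime K v).decompositionSubgroup (absoluteGaloisGroup K) := by
    rw [decompositionSubgroup_adicCompletionPrime_eq_range, resGal_eq_absGaloisRestrict]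
    exact ⟨g, rfl⟩
  exact smul_torsion_eq_self_of_mem_decompositionSubgroup W K hK hℓ hk v hv
    (adicCompletionPrime_mem_primesAbove K v) hd Q

variable {Dt : ModularParametrizationData W (W.conductorNorm ℤ)} {β : ℤ} {ι : K →+* ℂ}
  {p : ℕ} [Fact p.Prime] {k : ℕ} [∀ j : ℕ, NumberField (ringClassField K ι j)]
  {𝒯 : SelmerStructure ((W.baseChange K).torsionGaloisModule ((p ^ k : ℕ) : ℤ))}
  (h𝒯 : ∀ v : HeightOneSpectrum (𝓞 K), 𝒯 (Sum.inr v) =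
    ⨅ (ℓ : ℕ) (_ : ℓ.Prime ∧ (ℓ : 𝓞 K) ∈ v.asIdeal),
      ⨅ (w' : HeightOneSpectrum (𝓞 (ringClassField K ι ℓ)))
        (_ : w'.asIdeal.LiesOver v.asIdeal),
        letI := (adicCompletionOfLiesOver K (ringClassField K ι ℓ) v w').toAlgebra
        transverseSubgroup (GaloisRep.toLocal v ((W.baseChange K).torsionGaloisModule ((p ^ k : ℕ) : ℤ)))
          (w'.adicCompletion (ringClassField K ι ℓ)))

include h𝒯 in
/-- **The ROOT class is transverse at the primes of `s` (for the level-`k` global intrinsic family) as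
soon as `c_{k+u}(P_s)` lies in `transverseKer_{k+u} ℓ` for every `ℓ ∣ s`** — the reduction of the root
form of the gap `htr` to bsd-jet's form one level up (`ι_* c_k(Q) = c_{k+u}(P_s)`; cartesian transverse
condition at the places over the primes of `s`, whose local Galois groups fix `E[p^{k+u}]`).
[cite: Jetchev2008, §3.1 item 7, §3.1.2] [cite: McCallumLMS1991, §4 Lemma 4.6] [cite: GrossLMS1991, Prop. 9.6] -/
theorem localization_rootClass_mem_globalTransverse (hK : IsImaginaryQuadratic K) (hp2 : p ≠ 2)
    (hρ : W.HasSurjectiveModNGaloisRep p) {s : ℕ} (hs : Squarefree s) {u : ℕ}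
    (hsK : ∀ ℓ ∈ s.primeFactors, Zhang2014.IsKolyvaginPrime (W.conductorNorm ℤ) W K p ℓ ∧
      k + u ≤ Zhang2014.kolyvaginIndex W p ℓ)
    (d : KolyvaginHeegnerData Dt β ι s) (Q : (W.baseChange (ringClassField K ι s)).toAffine.Point)
    (hAk : IsAdmissible (absoluteGaloisGroup K) d.pointsSubgroup ((p ^ k : ℕ) : ℤ))
    (hQ : d.toGeomPoints Q ∈ invPoints (absoluteGaloisGroup K) d.pointsSubgroup ((p ^ k : ℕ) : ℤ))
    (hQP : ((p ^ u : ℕ) : ℤ) • Q = d.derivedPoint)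
    (hP : d.toGeomPoints d.derivedPoint ∈
      invPoints (absoluteGaloisGroup K) d.pointsSubgroup ((p ^ (k + u) : ℕ) : ℤ))
    (htr : ∀ ℓ ∈ s.primeFactors,
      (d.kolyvaginClass (Fact.out : p.Prime) (k + u) :
        galoisCohomology ((W.baseChange K).torsionGaloisModule ((p ^ (k + u) : ℕ) : ℤ)) 1) ∈
        transverseKer W K ι ((p ^ (k + u) : ℕ) : ℤ) ℓ) :
    ∀ v ∈ placesDividing K s,
      galoisCohomology.localization ((W.baseChange K).torsionGaloisModule ((p ^ k : ℕ) : ℤ)) (Sum.inr v) 1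
          (kolyvaginClass (W.baseChange K) ((p ^ k : ℕ) : ℤ)
            ((W.baseChange K).zsmul_geomPoints_surjective_of_charZero
              (by exact_mod_cast pow_ne_zero k (Fact.out : p.Prime).ne_zero)) hAk (d.toGeomPoints Q) hQ) ∈
        𝒯 (Sum.inr v) := by
  have hp : p.Prime := Fact.out
  have hs0 : s ≠ 0 := hs.ne_zero
  -- the global intrinsic family one level up and the transverse membership of `c_{k+u}(P_s)` there
  obtain ⟨𝒯', h𝒯', -⟩ := exists_globalTransverseFamily W ι ((p ^ (k + u) : ℕ) : ℤ)
  have hup : ∀ v ∈ placesDividing K s,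
      galoisCohomology.localization ((W.baseChange K).torsionGaloisModule ((p ^ (k + u) : ℕ) : ℤ))
          (Sum.inr v) 1 (d.kolyvaginClass hp (k + u)) ∈ 𝒯' (Sum.inr v) :=
    (globalTransverse_mem_iff h𝒯' hs _).mpr htr
  intro v hv
  -- `v` lies over a prime `ℓ₀ ∣ s`, Kolyvagin of index `≥ k + u`: `Γ_{K_v}` fixes `E[p^{k+u}]`
  obtain ⟨ℓ₀, hℓ₀, hℓ₀v⟩ := (natCast_mem_iff_exists_primeFactor_mem hs0 v).mp
    ((mem_placesDividing_iff_natCast_mem hs0 v).mp hv)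
  have htriv : ∀ (g : absoluteGaloisGroup (v.adicCompletion K))
      (P : geomTorsion (W.baseChange K) ((p ^ (k + u) : ℕ) : ℤ)), resGal (K := K) (v.adicCompletion K) g • P = P :=
    resGal_adicCompletion_smul_torsion_eq_self W hK (hsK ℓ₀ hℓ₀).1 (hsK ℓ₀ hℓ₀).2 v hℓ₀v
  -- the cartesian property of the transverse condition under `ι_*` (corner-p1)
  have hdn : p ^ k ∣ p ^ (k + u) := pow_dvd_pow p (Nat.le_add_right k u)
  refine (localization_torsionH1OfDvd_mem_globalTransverse_iff W hdn h𝒯 h𝒯' v htriv _).mpr ?_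
  rw [torsionH1OfDvd_rootClass W hK hp hp2 hρ hs0 d k u Q hAk hQ hQP hP]
  exact hup v hv

include h𝒯 in
/-- **The supply's `hselmer` at one conductor FROM bsd-jet's `htr` shape one level up** (instead of the
root form): the class of a `p^u`-th root `Q` of `P_s` lies in `H_{𝓕(s)}`, GIVEN [GZ86 III (3.1)] in the
receptacle form, the invariance of `[P_s]` mod `p^{k+u}`, and `c_{k+u}(P_s) ∈ transverseKer_{k+u} ℓ` for
`ℓ ∣ s`. [cite: Jetchev2008, §3.1 item 7 (p. 817), Prop. 4.5–4.6] [cite: GrossLMS1991, §6 Prop. 6.2 (1)]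
[cite: GrossZagier1986, III (3.1)] [cite: Howard2004HeegnerKolyvagin, Lemma 2.7.3] -/
theorem rootClass_mem_selmerGroup_selmerF_of_levelUp (hK : IsImaginaryQuadratic K)
    (hD3 : NumberField.discr K ≠ -3) (hD4 : NumberField.discr K ≠ -4)
    (hH : SatisfiesHeegnerHypothesis (W.conductorNorm ℤ) K) (hp2 : p ≠ 2)
    (hρ : W.HasSurjectiveModNGaloisRep p)
    {n' : ℤ} (hcop' : IsCoprime (p : ℤ) n')
    (hGZ : ∀ (m : ℕ) (dm : KolyvaginHeegnerData Dt β ι m)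
      (γ : ringClassField K ι m ≃ₐ[ℚ] ringClassField K ι m), γ ∈ ringClassGal ι m →
      ∀ v : HeightOneSpectrum (𝓞 K), ¬ (W.baseChange K).HasGoodReductionAt v →
        n' • pointsMap (W.baseChange K) (v.adicCompletion K)
            (dm.toGeomPoints (pointGalHom W (ringClassField K ι m) γ dm.y)) ∈
          E0Receptacle (W.baseChange K) v ∧
        ∀ (ℓ : ℕ), ℓ ∈ m.primeFactors → ∀ (dm' : KolyvaginHeegnerData Dt β ι (m / ℓ))
          (hle : ringClassField K ι (m / ℓ) ≤ ringClassField K ι m),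
          n' • pointsMap (W.baseChange K) (v.adicCompletion K)
              (dm.toGeomPoints (pointGalHom W (ringClassField K ι m) γ
                (WeierstrassCurve.Affine.Point.map (W' := W)
                  ((RingClassField.inclusion ι hle).restrictScalars ℚ) dm'.y))) ∈
            E0Receptacle (W.baseChange K) v)
    {s : ℕ} (hs : Squarefree s) {u : ℕ}
    (hsK : ∀ ℓ ∈ s.primeFactors, Zhang2014.IsKolyvaginPrime (W.conductorNorm ℤ) W K p ℓ ∧
      k + u ≤ Zhang2014.kolyvaginIndex W p ℓ)
    (d : KolyvaginHeegnerData Dt β ι s) (Q : (W.baseChange (ringClassField K ι s)).toAffine.Point)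
    (hAk : IsAdmissible (absoluteGaloisGroup K) d.pointsSubgroup ((p ^ k : ℕ) : ℤ))
    (hQ : d.toGeomPoints Q ∈ invPoints (absoluteGaloisGroup K) d.pointsSubgroup ((p ^ k : ℕ) : ℤ))
    (hQP : ((p ^ u : ℕ) : ℤ) • Q = d.derivedPoint)
    (hP : d.toGeomPoints d.derivedPoint ∈
      invPoints (absoluteGaloisGroup K) d.pointsSubgroup ((p ^ (k + u) : ℕ) : ℤ))
    (htr : ∀ ℓ ∈ s.primeFactors,
      (d.kolyvaginClass (Fact.out : p.Prime) (k + u) :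
        galoisCohomology ((W.baseChange K).torsionGaloisModule ((p ^ (k + u) : ℕ) : ℤ)) 1) ∈
        transverseKer W K ι ((p ^ (k + u) : ℕ) : ℤ) ℓ) :
    (kolyvaginClass (W.baseChange K) ((p ^ k : ℕ) : ℤ)
        ((W.baseChange K).zsmul_geomPoints_surjective_of_charZero
          (by exact_mod_cast pow_ne_zero k (Fact.out : p.Prime).ne_zero)) hAk (d.toGeomPoints Q) hQ) ∈
      (selmerF W ((p ^ k : ℕ) : ℤ) 𝒯 (placesDividing K s)).selmerGroup := by
  have hp : p.Prime := Fact.out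
  have hs0 : s ≠ 0 := hs.ne_zero
  -- Kummer condition at every place not over a prime of `s`, at level `k + u`, then pulled back
  have hKum : ∀ v : Place K, (∀ ℓ ∈ s.primeFactors, ¬ PlaceOver K v ℓ) →
      galoisCohomology.localization ((W.baseChange K).torsionGaloisModule ((p ^ k : ℕ) : ℤ)) v 1
        (kolyvaginClass (W.baseChange K) ((p ^ k : ℕ) : ℤ)
          ((W.baseChange K).zsmul_geomPoints_surjective_of_charZero
            (by exact_mod_cast pow_ne_zero k hp.ne_zero)) hAk (d.toGeomPoints Q) hQ) ∈
        (W.baseChange K).kummerSelmerStructure ((p ^ k : ℕ) : ℤ) v := by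
    intro v hv
    refine localization_rootClass_mem_kummer W hK hp hp2 hρ hs0 d k u Q hAk hQ hQP hP v ?_
    exact localization_kolyvaginClass_mem_kummerSelmerStructure_of_GZ31
      (phi_heegnerPointOfConductor_mem_range_map_ringClassField_holds (W.conductorNorm ℤ) W K)
      (exists_generator_ringClassGalOver_holds (K := K)) hK hD3 hD4 hH hp2 hρ Dt β ι hcop' hGZ hs hsK d v hv
  exact (mem_selmerGroup_selmerF_iff W _ 𝒯 hs0 _).mpr
    ⟨hKum, localization_rootClass_mem_globalTransverse W h𝒯 hK hp2 hρ hs hsK d Q hAk hQ hQP hP htr⟩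

end Summit.BirchSwinnertonDyer.Rank1Residual.JET.Walk

end
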